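import Summits.Parity.GeneralizedHardyLittlewood.Theorems.ChenParityOracleBLAPHostParityFromBrickTypeIIClasses
import HarnessLib

/-!
# Route `ChenParityOracleBLAP` — crux S1 = `HostParityFromBrick` (stmt-Parity-20045): Type-II pieces — the bad pairs are few

Support file for the prime half `K1 → K2 → HP1` of S1 (Type-II dispatch of Vaughan's identity).
The hyperbolic region `R = {(m,n) : M < m ≤ 2M, V₀ < n ≤ y/m}` as a finite set of pairs
(`sum_region_eq_sum_pairs`), and the count of its BAD pairs — those whose `ρ`-adic class
`(i,c)` is not good (`¬(ρ^{i+c+2} ≤ y ∧ V₀ < ρ^c ∧ 4x^{1−δ} ≤ ρ^{i+c})`): they satisfy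
`y < ρ² mn` or `n < ρ V₀` or `mn < 4ρ² x^{1−δ}`, whence
`#bad ≤ 4(ρ−1) y + M + 4ρ² x^{1−δ}` (`card_badPairs_le`).

References: H. Iwaniec, E. Kowalski, *Analytic Number Theory* (2004), §13.4, §17.3
[IwaniecKowalski2004].
-/

namespace Summit.Parity.GeneralizedHardyLittlewood.Theorems

open Finset Real

/-- The hyperbolic region as a set of pairs:
`∑_{M<m≤2M} ∑_{V₀<n≤y/m} G(m,n) = ∑_{p ∈ R} G(p)`,
`R = {(m,n) ∈ (M,2M] × [1,y] : V₀ < n ≤ y/m}`. -/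
theorem sum_region_eq_sum_pairs (M y V₀ : ℕ) (G : ℕ → ℕ → ℝ) :
    ∑ m ∈ Ioc M (2 * M), ∑ n ∈ Ioc V₀ (y / m), G m n =
      ∑ p ∈ ((Ioc M (2 * M)) ×ˢ (Icc 1 y)).filter (fun p : ℕ × ℕ => p.2 ∈ Ioc V₀ (y / p.1)),
        G p.1 p.2 := by
  classical
  rw [Finset.sum_filter, Finset.sum_product]
  refine Finset.sum_congr rfl fun m _ => ?_
  rw [← Finset.sum_filter]
  congr 1
  ext n
  simp only [Finset.mem_filter, Finset.mem_Icc, Finset.mem_Ioc]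
  constructor
  · rintro ⟨h1, h2⟩; exact ⟨⟨by omega, h2.trans (Nat.div_le_self y m)⟩, h1, h2⟩
  · rintro ⟨-, h1, h2⟩; exact ⟨h1, h2⟩

/-- `∑_{M < m ≤ 2M} 1/m ≤ 1`. -/
theorem sum_inv_Ioc_dyadic_le_one (M : ℕ) : ∑ m ∈ Ioc M (2 * M), (1 : ℝ) / m ≤ 1 := by
  rcases Nat.eq_zero_or_pos M with rfl | hM
  · simp
  have hM0 : (0 : ℝ) < M := by exact_mod_cast hM
  calc ∑ m ∈ Ioc M (2 * M), (1 : ℝ) / m ≤ ∑ m ∈ Ioc M (2 * M), (1 : ℝ) / M := by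
        refine Finset.sum_le_sum fun m hm => ?_
        rw [Finset.mem_Ioc] at hm
        exact one_div_le_one_div_of_le hM0 (by exact_mod_cast hm.1.le)
    _ = 1 := by
        rw [Finset.sum_const, Nat.card_Ioc, nsmul_eq_mul]
        have : ((2 * M - M : ℕ) : ℝ) = M := by
          rw [show 2 * M - M = M by omega]
        rw [this]; field_simp

/-- Per-`m` count (a): `#{V₀ < n ≤ y/m : y < ρ² m n} ≤ (1 − ρ⁻²) y/m + 1 ≤ 3(ρ−1) y/m + 1`. -/
theorem card_top_slice_le {ρ : ℝ} (hρ : 1 < ρ) (hρ2 : ρ ≤ 6 / 5) {m : ℕ} (hm : 1 ≤ m)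
    (y V₀ : ℕ) :
    (#((Ioc V₀ (y / m)).filter (fun n : ℕ => (y : ℝ) < ρ ^ 2 * ((m : ℝ) * n))) : ℝ) ≤
      3 * (ρ - 1) * ((y : ℝ) / m) + 1 := by
  have hm0 : (0 : ℝ) < m := by exact_mod_cast hm
  have hρ0 : (0 : ℝ) < ρ := by linarith
  set L : ℝ := (y : ℝ) / (ρ ^ 2 * m) with hL
  have hL0 : 0 ≤ L := by positivity
  -- the slice sits inside `Ioc ⌊L⌋ (y/m)`
  have hsub : (Ioc V₀ (y / m)).filter (fun n : ℕ => (y : ℝ) < ρ ^ 2 * ((m : ℝ) * n)) ⊆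
      Ioc ⌊L⌋₊ (y / m) := by
    intro n hn
    rw [Finset.mem_filter, Finset.mem_Ioc] at hn
    rw [Finset.mem_Ioc]
    refine ⟨?_, hn.1.2⟩
    have : L < n := by
      rw [hL, div_lt_iff₀ (by positivity)]; linarith [hn.2]
    exact Nat.floor_lt hL0 |>.mpr this
  have h1 : (#((Ioc V₀ (y / m)).filter (fun n : ℕ => (y : ℝ) < ρ ^ 2 * ((m : ℝ) * n))) : ℝ) ≤
      ((y / m - ⌊L⌋₊ : ℕ) : ℝ) := by
    have := Finset.card_le_card hsub
    rw [Nat.card_Ioc] at this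
    exact_mod_cast this
  refine h1.trans ?_
  have h2 : ((y / m - ⌊L⌋₊ : ℕ) : ℝ) ≤ (y : ℝ) / m - L + 1 := by
    have hfl : L - 1 < (⌊L⌋₊ : ℝ) := by linarith [Nat.lt_floor_add_one L]
    have hdiv : ((y / m : ℕ) : ℝ) ≤ (y : ℝ) / m := Nat.cast_div_le
    rcases le_total (y / m) ⌊L⌋₊ with h | h
    · rw [Nat.sub_eq_zero_of_le h, Nat.cast_zero]
      have : L ≤ (y : ℝ) / m := by
        rw [hL]; exact div_le_div_of_nonneg_left (Nat.cast_nonneg y) hm0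
          (le_mul_of_one_le_left hm0.le (one_le_pow₀ hρ.le))
      linarith
    · rw [Nat.cast_sub h]; linarith
  refine h2.trans ?_
  -- `y/m - L = (y/m)(1 - ρ⁻²) ≤ 3(ρ-1) y/m`
  have h3 : (y : ℝ) / m - L = ((y : ℝ) / m) * (1 - (ρ ^ 2)⁻¹) := by
    rw [hL]; field_simp
  rw [h3]
  have h4 : 1 - (ρ ^ 2)⁻¹ ≤ 3 * (ρ - 1) := by
    have ht : 0 < ρ ^ 2 := by positivity
    rw [inv_eq_one_div, show 1 - 1 / ρ ^ 2 = (ρ ^ 2 - 1) / ρ ^ 2 by field_simp,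
      div_le_iff₀ ht]
    nlinarith [sq_nonneg (ρ - 1)]
  have h5 : 0 ≤ (y : ℝ) / m := by positivity
  have h6 := mul_le_mul_of_nonneg_left h4 h5
  linarith

/-- Per-`m` count (b): `#{V₀ < n ≤ y/m : n < ρ V₀} ≤ (ρ − 1) y/m`. -/
theorem card_V0_slice_le {ρ : ℝ} (hρ : 1 < ρ) {m : ℕ} (hm : 1 ≤ m) (y V₀ : ℕ) :
    (#((Ioc V₀ (y / m)).filter (fun n : ℕ => (n : ℝ) < ρ * V₀)) : ℝ) ≤ (ρ - 1) * ((y : ℝ) / m) := by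
  have hm0 : (0 : ℝ) < m := by exact_mod_cast hm
  rcases le_or_gt (y / m) V₀ with h | h
  · -- empty range
    have : Ioc V₀ (y / m) = ∅ := Finset.Ioc_eq_empty (by omega)
    rw [this, Finset.filter_empty, Finset.card_empty, Nat.cast_zero]
    have : (0 : ℝ) ≤ ρ - 1 := by linarith
    positivity
  · -- `V₀ < y/m`: the slice is inside `Ioc V₀ ⌊?⌋`, of length `< (ρ-1) V₀ + 1`... count exactly
    have hV : (V₀ : ℝ) < (y : ℝ) / m := by
      have : ((y / m : ℕ) : ℝ) ≤ (y : ℝ) / m := Nat.cast_div_le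
      exact lt_of_lt_of_le (by exact_mod_cast h) this
    have hsub : (Ioc V₀ (y / m)).filter (fun n : ℕ => (n : ℝ) < ρ * V₀) ⊆
        Ioc V₀ (⌈ρ * V₀⌉₊ - 1) := by
      intro n hn
      rw [Finset.mem_filter, Finset.mem_Ioc] at hn
      rw [Finset.mem_Ioc]
      refine ⟨hn.1.1, ?_⟩
      have : n < ⌈ρ * (V₀ : ℝ)⌉₊ := Nat.lt_ceil.mpr hn.2
      omega
    have h1 := Finset.card_le_card hsub
    rw [Nat.card_Ioc] at h1
    have h2 : ((⌈ρ * (V₀ : ℝ)⌉₊ - 1 - V₀ : ℕ) : ℝ) ≤ (ρ - 1) * V₀ := by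
      have hceil : (⌈ρ * (V₀ : ℝ)⌉₊ : ℝ) < ρ * V₀ + 1 := Nat.ceil_lt_add_one (by positivity)
      rcases Nat.eq_zero_or_pos V₀ with hV0 | hV0
      · subst hV0; simp
      · have hρV : (V₀ : ℝ) ≤ ρ * V₀ := le_mul_of_one_le_left (Nat.cast_nonneg _) hρ.le
        have hc1 : V₀ + 1 ≤ ⌈ρ * (V₀ : ℝ)⌉₊ ∨ ⌈ρ * (V₀ : ℝ)⌉₊ - 1 - V₀ = 0 := by omega
        rcases hc1 with hc1 | hc1
        · rw [Nat.cast_sub (by omega), Nat.cast_sub (by omega)]; push_cast; linarith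
        · rw [hc1, Nat.cast_zero]; nlinarith
    calc (#((Ioc V₀ (y / m)).filter (fun n : ℕ => (n : ℝ) < ρ * V₀)) : ℝ)
        ≤ ((⌈ρ * (V₀ : ℝ)⌉₊ - 1 - V₀ : ℕ) : ℝ) := by exact_mod_cast h1
      _ ≤ (ρ - 1) * V₀ := h2
      _ ≤ (ρ - 1) * ((y : ℝ) / m) := mul_le_mul_of_nonneg_left hV.le (by linarith)

/-- Per-`m` count (c): `#{1 ≤ n ≤ y : m n < L₀} ≤ L₀/m` (`L₀ ≥ 0`). -/
theorem card_low_slice_le {m : ℕ} (hm : 1 ≤ m) (y : ℕ) {L₀ : ℝ} (hL₀ : 0 ≤ L₀) (S : Finset ℕ)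
    (hS : S ⊆ Icc 1 y) :
    (#(S.filter (fun n : ℕ => ((m : ℝ) * n) < L₀)) : ℝ) ≤ L₀ / m := by
  have hm0 : (0 : ℝ) < m := by exact_mod_cast hm
  have hsub : S.filter (fun n : ℕ => ((m : ℝ) * n) < L₀) ⊆ Icc 1 ⌊L₀ / m⌋₊ := by
    intro n hn
    rw [Finset.mem_filter] at hn
    have h1 := hS hn.1
    rw [Finset.mem_Icc] at h1 ⊢
    refine ⟨h1.1, Nat.le_floor ?_⟩
    rw [le_div_iff₀ hm0]; linarith [hn.2]
  have := Finset.card_le_card hsub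
  rw [Nat.card_Icc] at this
  calc (#(S.filter (fun n : ℕ => ((m : ℝ) * n) < L₀)) : ℝ) ≤ ((⌊L₀ / m⌋₊ + 1 - 1 : ℕ) : ℝ) := by
        exact_mod_cast this
    _ = ⌊L₀ / m⌋₊ := by simp
    _ ≤ L₀ / m := Nat.floor_le (by positivity)

/-- **The bad pairs are few.**  For `ρ ∈ (1, 6/5]`:
`#{(m,n) ∈ R : ¬ good(cls m, cls n)} ≤ 4(ρ−1) y + M + 4ρ² x^{1−δ}`,
where `good(i,c) = (ρ^{i+c+2} ≤ y ∧ V₀ < ρ^c ∧ 4x^{1−δ} ≤ ρ^{i+c})`. -/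
theorem card_badPairs_le {ρ : ℝ} (hρ : 1 < ρ) (hρ2 : ρ ≤ 6 / 5) (x M y V₀ : ℕ) (δ : ℝ) :
    (#((((Ioc M (2 * M)) ×ˢ (Icc 1 y)).filter (fun p : ℕ × ℕ => p.2 ∈ Ioc V₀ (y / p.1))).filter
        (fun p : ℕ × ℕ => ¬ (ρ ^ (⌊Real.log (p.1 : ℝ) / Real.log ρ⌋₊ +
            ⌊Real.log (p.2 : ℝ) / Real.log ρ⌋₊ + 2) ≤ (y : ℝ) ∧
          (V₀ : ℝ) < ρ ^ ⌊Real.log (p.2 : ℝ) / Real.log ρ⌋₊ ∧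
          4 * (x : ℝ) ^ (1 - δ) ≤ ρ ^ (⌊Real.log (p.1 : ℝ) / Real.log ρ⌋₊ +
            ⌊Real.log (p.2 : ℝ) / Real.log ρ⌋₊)))) : ℝ) ≤
      4 * (ρ - 1) * y + M + 4 * ρ ^ 2 * (x : ℝ) ^ (1 - δ) := by
  classical
  have hρ0 : (0 : ℝ) < ρ := by linarith
  set R := ((Ioc M (2 * M)) ×ˢ (Icc 1 y)).filter (fun p : ℕ × ℕ => p.2 ∈ Ioc V₀ (y / p.1)) with hR
  set L₀ : ℝ := 4 * ρ ^ 2 * (x : ℝ) ^ (1 - δ) with hL₀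
  have hL₀0 : 0 ≤ L₀ := by positivity
  -- the three slices
  set A := R.filter (fun p : ℕ × ℕ => (y : ℝ) < ρ ^ 2 * ((p.1 : ℝ) * p.2)) with hA
  set B := R.filter (fun p : ℕ × ℕ => (p.2 : ℝ) < ρ * V₀) with hB
  set C := R.filter (fun p : ℕ × ℕ => ((p.1 : ℝ) * p.2) < L₀) with hC
  have hcover : R.filter (fun p : ℕ × ℕ => ¬ (ρ ^ (⌊Real.log (p.1 : ℝ) / Real.log ρ⌋₊ +
            ⌊Real.log (p.2 : ℝ) / Real.log ρ⌋₊ + 2) ≤ (y : ℝ) ∧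
          (V₀ : ℝ) < ρ ^ ⌊Real.log (p.2 : ℝ) / Real.log ρ⌋₊ ∧
          4 * (x : ℝ) ^ (1 - δ) ≤ ρ ^ (⌊Real.log (p.1 : ℝ) / Real.log ρ⌋₊ +
            ⌊Real.log (p.2 : ℝ) / Real.log ρ⌋₊))) ⊆ A ∪ B ∪ C := by
    intro p hp
    rw [Finset.mem_filter] at hp
    obtain ⟨hpR, hbad⟩ := hp
    have hpR' := hpR
    simp only [hR, Finset.mem_filter, Finset.mem_product, Finset.mem_Ioc, Finset.mem_Icc] at hpR'
    obtain ⟨⟨⟨hm1, -⟩, hn1, -⟩, -, -⟩ := hpR'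
    obtain ⟨hmlo, hmhi⟩ := rho_class_bounds hρ (by omega : 1 ≤ p.1) rfl
    obtain ⟨hnlo, hnhi⟩ := rho_class_bounds hρ hn1 rfl
    set i := ⌊Real.log (p.1 : ℝ) / Real.log ρ⌋₊
    set c := ⌊Real.log (p.2 : ℝ) / Real.log ρ⌋₊
    rw [Finset.mem_union, Finset.mem_union]
    by_cases h1 : ρ ^ (i + c + 2) ≤ (y : ℝ)
    · by_cases h2 : (V₀ : ℝ) < ρ ^ c
      · -- then the third condition fails
        have h3 : ¬ 4 * (x : ℝ) ^ (1 - δ) ≤ ρ ^ (i + c) := fun h3 => hbad ⟨h1, h2, h3⟩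
        right
        rw [hC, Finset.mem_filter]
        refine ⟨hpR, ?_⟩
        push Not at h3
        calc (p.1 : ℝ) * p.2 < ρ ^ (i + 1) * ρ ^ (c + 1) :=
              mul_lt_mul'' hmhi hnhi (Nat.cast_nonneg _) (Nat.cast_nonneg _)
          _ = ρ ^ 2 * ρ ^ (i + c) := by rw [← pow_add, ← pow_add]; ring_nf
          _ < ρ ^ 2 * (4 * (x : ℝ) ^ (1 - δ)) := mul_lt_mul_of_pos_left h3 (by positivity)
          _ = L₀ := by rw [hL₀]; ring
      · left; right
        rw [hB, Finset.mem_filter]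
        refine ⟨hpR, ?_⟩
        push Not at h2
        calc (p.2 : ℝ) < ρ ^ (c + 1) := hnhi
          _ = ρ * ρ ^ c := by rw [pow_succ]; ring
          _ ≤ ρ * V₀ := mul_le_mul_of_nonneg_left h2 hρ0.le
    · left; left
      rw [hA, Finset.mem_filter]
      refine ⟨hpR, ?_⟩
      push Not at h1
      calc (y : ℝ) < ρ ^ (i + c + 2) := h1
        _ = ρ ^ 2 * (ρ ^ i * ρ ^ c) := by rw [← pow_add, ← pow_add]; ring_nf
        _ ≤ ρ ^ 2 * ((p.1 : ℝ) * p.2) :=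
            mul_le_mul_of_nonneg_left (mul_le_mul hmlo hnlo (by positivity) (Nat.cast_nonneg _))
              (by positivity)
  -- counting each slice by fibres over `m`
  have hfib : ∀ (P : ℕ × ℕ → Prop) [DecidablePred P],
      #(R.filter P) = ∑ m ∈ Ioc M (2 * M), #((Ioc V₀ (y / m)).filter (fun n => P (m, n))) := by
    intro P _
    rw [Finset.card_eq_sum_ones, Finset.sum_filter, hR, Finset.sum_filter, Finset.sum_product]
    refine Finset.sum_congr rfl fun m _ => ?_
    rw [Finset.card_eq_sum_ones, Finset.sum_filter, ← Finset.sum_filter (s := Icc 1 y)]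
    congr 1
    ext n
    simp only [Finset.mem_filter, Finset.mem_Icc, Finset.mem_Ioc]
    constructor
    · rintro ⟨-, h1, h2⟩; exact ⟨h1, h2⟩
    · rintro ⟨h1, h2⟩; exact ⟨⟨by omega, h2.trans (Nat.div_le_self y m)⟩, h1, h2⟩
  have hAcard : (#A : ℝ) ≤ 3 * (ρ - 1) * y + M := by
    rw [hA, hfib]
    push_cast
    calc ∑ m ∈ Ioc M (2 * M), (#((Ioc V₀ (y / m)).filter
          (fun n : ℕ => (y : ℝ) < ρ ^ 2 * ((m : ℝ) * n))) : ℝ)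
        ≤ ∑ m ∈ Ioc M (2 * M), (3 * (ρ - 1) * ((y : ℝ) / m) + 1) :=
          Finset.sum_le_sum fun m hm => card_top_slice_le hρ hρ2
            (by rw [Finset.mem_Ioc] at hm; omega) y V₀
      _ = 3 * (ρ - 1) * y * ∑ m ∈ Ioc M (2 * M), (1 : ℝ) / m + #(Ioc M (2 * M)) := by
          rw [Finset.sum_add_distrib, Finset.sum_const, nsmul_eq_mul, mul_one, Finset.mul_sum]
          congr 1; refine Finset.sum_congr rfl fun m _ => ?_; ring
      _ ≤ 3 * (ρ - 1) * y * 1 + M := by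
          have hc : (#(Ioc M (2 * M)) : ℝ) ≤ M := by
            rw [Nat.card_Ioc]; exact_mod_cast (by omega : 2 * M - M ≤ M)
          have hnn : 0 ≤ 3 * (ρ - 1) * (y : ℝ) := by
            have : (0 : ℝ) ≤ ρ - 1 := by linarith
            positivity
          exact add_le_add (mul_le_mul_of_nonneg_left (sum_inv_Ioc_dyadic_le_one M) hnn) hc
      _ = 3 * (ρ - 1) * y + M := by ring
  have hBcard : (#B : ℝ) ≤ (ρ - 1) * y := by
    rw [hB, hfib]
    push_cast
    calc ∑ m ∈ Ioc M (2 * M), (#((Ioc V₀ (y / m)).filter (fun n : ℕ => (n : ℝ) < ρ * V₀)) : ℝ)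
        ≤ ∑ m ∈ Ioc M (2 * M), (ρ - 1) * ((y : ℝ) / m) :=
          Finset.sum_le_sum fun m hm => card_V0_slice_le hρ (by rw [Finset.mem_Ioc] at hm; omega) y V₀
      _ = (ρ - 1) * y * ∑ m ∈ Ioc M (2 * M), (1 : ℝ) / m := by
          rw [Finset.mul_sum]; refine Finset.sum_congr rfl fun m _ => ?_; ring
      _ ≤ (ρ - 1) * y * 1 := by
          refine mul_le_mul_of_nonneg_left (sum_inv_Ioc_dyadic_le_one M) ?_
          exact mul_nonneg (by linarith) (Nat.cast_nonneg y)
      _ = (ρ - 1) * y := by ring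
  have hCcard : (#C : ℝ) ≤ L₀ := by
    rw [hC, hfib]
    push_cast
    calc ∑ m ∈ Ioc M (2 * M), (#((Ioc V₀ (y / m)).filter (fun n : ℕ => ((m : ℝ) * n) < L₀)) : ℝ)
        ≤ ∑ m ∈ Ioc M (2 * M), L₀ / m :=
          Finset.sum_le_sum fun m hm => card_low_slice_le (by rw [Finset.mem_Ioc] at hm; omega)
            y hL₀0 _ (fun n hn => by rw [Finset.mem_Ioc] at hn; rw [Finset.mem_Icc]; exact
              ⟨by omega, hn.2.trans (Nat.div_le_self y m)⟩)
      _ = L₀ * ∑ m ∈ Ioc M (2 * M), (1 : ℝ) / m := by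
          rw [Finset.mul_sum]; refine Finset.sum_congr rfl fun m _ => ?_; ring
      _ ≤ L₀ * 1 := mul_le_mul_of_nonneg_left (sum_inv_Ioc_dyadic_le_one M) hL₀0
      _ = L₀ := mul_one _
  calc (#(R.filter _) : ℝ) ≤ #(A ∪ B ∪ C) := by exact_mod_cast Finset.card_le_card hcover
    _ ≤ #A + #B + #C := by
        have h1 := Finset.card_union_le (A ∪ B) C
        have h2 := Finset.card_union_le A B
        exact_mod_cast h1.trans (Nat.add_le_add_right h2 _)
    _ ≤ 3 * (ρ - 1) * y + M + (ρ - 1) * y + L₀ := by linarith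
    _ = 4 * (ρ - 1) * y + M + 4 * ρ ^ 2 * (x : ℝ) ^ (1 - δ) := by rw [hL₀]; ring

end Summit.Parity.GeneralizedHardyLittlewood.Theorems
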